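import Mathlib
import Summits.NavierStokesRegularity.NavierStokesRegularity.Theses.DirectionDissipationQuantum
import Literature.Analysis.FluidPDE.NSCriticalClosureBesovKatoClass
import HarnessLib

/-!
# `DirectionDissipationQuantum.BoundedNearTopExtends` — local boundedness below the top at every point
  forces a smooth extension (route `DirectionDissipationQuantum`, item stmt-NavierStokesRegularity-1924,
  support; GLUE of proved cone facts)

**Statement.** A classical Leray–Hopf solution from a rapidly decaying datum on `[0,T)` which is
bounded on some backward box `(T − r², T) × B(x, r)` at EVERY `x` extends smoothly past `T`.

PROOF. Otherwise Lemarié-Rieusset's Thm. 15.1 (C) (tree: `exists_singularPoint_of_classical_of_not_hasSmoothExtensionPast`)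
gives a point `x₀` with `‖u‖_{L^∞(Q_r(T,x₀))} = ∞` for every small `r`, while the hypothesis at `x₀`
bounds `u` by `M` on `Q_r(T,x₀) = (T − r², T) × B(x₀, r)` for some `r` (shrink it below `√T`).

HONEST FRAMING: a continuation criterion about a HYPOTHETICAL solution; nothing here bears on the
regularity problem itself.
-/

noncomputable section

set_option linter.dupNamespace false

namespace Summit.NavierStokesRegularity.NavierStokesRegularity.Theorems

open MeasureTheory Set Function Metric
open scoped ENNReal
open Literature.Analysis Literature.Analysis.FluidPDE

/-- An essential `L^∞` bound on a parabolic cylinder from a pointwise bound on it. [folklore] -/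
theorem eLpNorm_top_parabolicCylinder_le_of_bound {u : ℝ → EuclideanSpace ℝ (Fin 3) → EuclideanSpace ℝ (Fin 3)}
    {T r M : ℝ} {x₀ : EuclideanSpace ℝ (Fin 3)}
    (h : ∀ t ∈ Ioo (T - r ^ 2) T, ∀ y ∈ ball x₀ r, ‖u t y‖ ≤ M) :
    eLpNorm (uncurry u) ∞ (volume.restrict (parabolicCylinder r ((T : ℝ), x₀))) ≤ ENNReal.ofReal M := by
  rw [eLpNorm_exponent_top]
  refine eLpNormEssSup_le_of_ae_bound (ae_restrict_of_forall_mem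
    (measurableSet_Ioo.prod measurableSet_ball) fun z hz => ?_)
  exact h z.1 hz.1 z.2 hz.2

/-- **Item stmt-NavierStokesRegularity-1924** (`DirectionDissipationQuantum.BoundedNearTopExtends`): local
boundedness below the top at every point implies `HasSmoothExtensionPast` (contrapositive of the
singular-point theorem). [this file] -/
theorem directionDissipationQuantum_boundedNearTopExtends_proof :
    Summit.NavierStokesRegularity.NavierStokesRegularity.Theses.DirectionDissipationQuantum.BoundedNearTopExtends := by
  unfold Summit.NavierStokesRegularity.NavierStokesRegularity.Theses.DirectionDissipationQuantum.BoundedNearTopExtends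
  intro ν T hν hT u p hsol hLH hdec hloc
  by_contra hext
  obtain ⟨x₀, hx₀⟩ := exists_singularPoint_of_classical_of_not_hasSmoothExtensionPast hν hT hsol hLH hdec hext
  obtain ⟨r, hr, M, hM⟩ := hloc x₀
  -- shrink the radius below `√T`
  set ρ : ℝ := min r (Real.sqrt T / 2) with hρ
  have hρpos : 0 < ρ := lt_min hr (by positivity)
  have hρr : ρ ≤ r := min_le_left _ _
  have hρT : ρ ^ 2 < T := by
    have h1 : ρ ≤ Real.sqrt T / 2 := min_le_right _ _
    have h2 : Real.sqrt T ^ 2 = T := Real.sq_sqrt hT.le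
    nlinarith [Real.sqrt_pos.2 hT]
  have hbound : ∀ t ∈ Ioo (T - ρ ^ 2) T, ∀ y ∈ ball x₀ ρ, ‖u t y‖ ≤ M := by
    intro t ht y hy
    refine hM t ⟨?_, ht.2⟩ y (ball_subset_ball hρr hy)
    have : ρ ^ 2 ≤ r ^ 2 := pow_le_pow_left₀ hρpos.le hρr 2
    linarith [ht.1]
  have hle := eLpNorm_top_parabolicCylinder_le_of_bound hbound
  rw [hx₀ ρ hρpos hρT] at hle
  exact absurd hle (not_le.2 ENNReal.ofReal_lt_top)

end Summit.NavierStokesRegularity.NavierStokesRegularity.Theorems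

end
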